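import Literature.NumberTheory.QuadraticFields.BinaryQuadraticFormsClassNumberCount
import HarnessLib

/-!
# Class numbers of imaginary quadratic discriminants at the bed's DEEP ladder rungs, part (a):
# `h(−1 333 963) = 79`, `h(−2 404 147) = 107`

Topic `NumberTheory/QuadraticFields`, namespace `Literature.NumberTheory.QuadraticFields.Quadratic`; pure VALUES file (theorems
only): the form class number `BinQF.classNumber D = h(D)` of `BinaryQuadraticFormsClassNumber.lean` (the number of reduced primitive
positive definite forms of discriminant `D`, Cox Thm. 2.13) at the two least-deep NEGATIVE rungs `|D| > 10⁶` of the landau-siegel rescue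
bed's least-all-inert ladder (bed-1 spec `bed1-KG1-v0.1`, list `L1y`: `D_y^−` = the negative fundamental discriminant of least
absolute value with `χ_D(p) = −1` for every prime `p ≤ y`; Lehmer–Lehmer–Shanks 1970, Table), evaluated by `decide +kernel` through the
pair counter `BinQF.classNumberCount` of `BinaryQuadraticFormsClassNumberCount.lean` (Cohen's Algorithm 5.3.5,
`BinQF.classNumber_eq_classNumberCount`; kernel time ≈ `|D|/130 000` s, one declaration each — the candidate enumeration behind
`BinQF.classNumber` itself would need ≈ 40 s per 10⁵ of `|D|`; the deeper rungs `|D| > 2·10⁷` exceed one declaration's kernel budget and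
are evaluated in row chunks in parts (b)–(d)). The values agree with the bed's two engine lineages (A = PARI `quadclassunit`, B = reduced
forms; referee join `kg1deep`, `G01_h` exact).

| `D` | factorisation | `h(D)` | ladder rung |
|---|---|---|---|
| `−1 333 963` | prime | `79` | `D_47^−` |
| `−2 404 147` | prime | `107` | `D_53^− = D_59^−` |

Parts (b)–(d) carry `D_61^− = −20 950 603`, `D_67^− = −36 254 563` and `D_71^− = −51 599 563`. First consumer:
`Zhang2022/RepairBedClassNumberFormulaNegDeep.lean` (`L(1, χ_D) = πh/√|D|` at these rungs).

## References

* [Cox2013] D. A. Cox, *Primes of the form x² + ny²*, 2nd ed. (2013), §2.A Thm. 2.8, Thm. 2.13.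
* [Cohen1993] H. Cohen, *A Course in Computational Algebraic Number Theory*, GTM 138, §5.3.1 Algorithm 5.3.5.
* [LehmerLehmerShanks1970] D. H. Lehmer, E. Lehmer, D. Shanks, *Integer sequences having prescribed quadratic character*,
  Math. Comp. 24 (1970) 433–451, §1 and Table (the least-all-inert discriminants).
-/

namespace Literature.NumberTheory.QuadraticFields.Quadratic

/-- **`h(−1 333 963) = 79`** (`1 333 963` prime; the ladder rung `D_47^−`; kernel count of the reduced forms by Cohen's
Algorithm 5.3.5). [cite: Cox2013, Thm. 2.13] -/
theorem binQFClassNumber_neg1333963 : BinQF.classNumber (-1333963) = 79 := by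
  rw [BinQF.classNumber_eq_classNumberCount (by norm_num)]
  decide +kernel

/-- **`h(−2 404 147) = 107`** (`2 404 147` prime; the ladder rung `D_53^− = D_59^−`; kernel count of the reduced forms by Cohen's
Algorithm 5.3.5). [cite: Cox2013, Thm. 2.13] -/
theorem binQFClassNumber_neg2404147 : BinQF.classNumber (-2404147) = 107 := by
  rw [BinQF.classNumber_eq_classNumberCount (by norm_num)]
  decide +kernel

end Literature.NumberTheory.QuadraticFields.Quadratic
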